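import Mathlib
import HarnessLib.Audit
import Summits.PneNP.PneNP.Theorems.PstarGapSupport
import Summits.PneNP.PneNP.Theorems.PstarGConstraint
import Summits.PneNP.PneNP.Theorems.PstarReaderCoreSystem
import Summits.PneNP.PneNP.Theorems.PstarChordEndgameTools

/-!
# The support-charged bound for G-constraint systems (ROUND-24, GAPTWO-PLAN §2 (★) / §4 S2, chord–support count)

FRONTIER range-avoidance ladder, rung F-N3, ROUND 24 (cell `pnp-ideate`, planner memo `r24/GAPTWO-PLAN.md` v0 §2; restricted-model
proof complexity — nothing here bears on `P` versus `NP`).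

After the preprocessing for `|W| ≥ 2` (`PstarReaderCoreSystem`, `PstarGSystemFreeVar`, `PstarGSystemFold`) a minimal infeasible
pair `(J, W)` becomes a CORE `J₀` that is minimally unsolvable together with a finite SYSTEM `𝒲` of G-constraints
`(C, G, b)` ("`gval I C G z = b`", i.e. `Σ_{v∈C} z_v + Σ_{g∈G} z_{p_g} z_{q_g} = b`), whose monomial sets record the folded outputs.
This file ports the support-charged gap bound of `PstarGapSupport` (parity systems) to that language.

* `csupp I (C,G,b) = C ∪ ⋃_{g∈G} andPair g` and `gsupp I 𝒲 = ⋃_{w∈𝒲} csupp w` — the variables a system reads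
  (`gval_update_of_notMem_csupp`: nothing else matters; `gsupp_parity`: for a parity system it is `PstarGapSupport.wsupp`).
* `solvable_of_two_private` — an output `j ∈ J` owning two `J`-private variables OUTSIDE `gsupp 𝒲` is removable: a solution of
  `J ∖ {j}` with `𝒲` is repaired into one of `J` with `𝒲` (flip a private XOR slot, or set the private AND pair to `(c,c)`; the
  system does not read the touched variables).  This is (C0) of the memo ("a chord of `J₀` touching no constraint-support variable is
  removable") in its general form.
* `card_bdry_sdiff_gsupp_le` — hence a minimally unsolvable `J` (unsolvable with `𝒲`, every `J ∖ {j}` solvable with `𝒲`) has at most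
  `|J|` boundary variables outside `gsupp 𝒲`; with `(r, 3/2)`-boundary expansion and `|J| ≤ r`:
  **`card_le_two_mul_card_bdry_inter_gsupp`: `|J| ≤ 2·|bdry J ∩ gsupp 𝒲|`** — the count (★) `|J₀| ≤ 2·|S ∩ priv(J₀)|` of the memo,
  WITHOUT the terminal-form hypothesis (T1); and `|J| ≤ 2·|gsupp 𝒲| ≤ 2·Σ_w (|C_w| + 2|G_w|)`.
* Under (T1) (no `J`-private XOR slot) the charged boundary consists of AND-slot variables of `J`
  (`bdry_subset_biUnion_andPair`, `card_le_two_mul_card_andBdry_inter_gsupp`), so only the AND-typed part of the linear sets `C_w`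
  and the monomial pairs are ever charged — the quantity GAPTWO-PLAN S4 has to bound.

Only `IsPure` (and expansion for the counts) is used: no typedness, no simple overlaps, no degree bound.
-/

set_option linter.dupNamespace false -- `Summit.PneNP.PneNP.…`: summit = sub-problem name (D-0017 single-conjunct layout)

open Finset Literature.Computability.Complexity
open Summit.PneNP.PneNP.Theorems.PstarPDT (parity)
open Summit.PneNP.PneNP.Theorems.PstarSALevel (varSet bdry BoundaryExpanding)
open Summit.PneNP.PneNP.Theorems.PstarSAClosure (exists_two_private)
open Summit.PneNP.PneNP.Theorems.PstarGapLinearised (andPair)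
open Summit.PneNP.PneNP.Theorems.PstarGapPeeling (not_mem_varSet_of_private eval_update_of_not_mem eval_update_xor_slot
  eval_update_and_pair)
open Summit.PneNP.PneNP.Theorems.PstarGapSupport (wsupp mem_wsupp)
open Summit.PneNP.PneNP.Theorems.PstarGapOneAll (gval)
open Summit.PneNP.PneNP.Theorems.PstarGConstraint (gval_update_of_forall_ne)
open Summit.PneNP.PneNP.Theorems.PstarReaderCoreSystem (ofParity)
open Summit.PneNP.PneNP.Theorems.PstarChordRepair (IsChord)
open Summit.PneNP.PneNP.Theorems.PstarGapOneKills (mem_andPair_of_slot)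

namespace Summit.PneNP.PneNP.Theorems.PstarGSystemSupport

variable {n m : ℕ}

/-! ## Supports of G-constraints and of systems -/

/-- The support of one G-constraint `(C, G, b)`: the linear variables `C` and the AND pairs of the monomials `G`. -/
def csupp (I : LocalMap 4 n m) (w : Finset (Fin n) × Finset (Fin m) × Bool) : Finset (Fin n) :=
  w.1 ∪ w.2.1.biUnion (andPair I)

/-- The total support of a G-constraint system: all variables read by some constraint. -/
def gsupp (I : LocalMap 4 n m) (𝒲 : Finset (Finset (Fin n) × Finset (Fin m) × Bool)) : Finset (Fin n) :=
  𝒲.biUnion (csupp I)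

/-- Membership in the support of one constraint. -/
theorem mem_csupp {I : LocalMap 4 n m} {w : Finset (Fin n) × Finset (Fin m) × Bool} {v : Fin n} :
    v ∈ csupp I w ↔ v ∈ w.1 ∨ ∃ g ∈ w.2.1, v ∈ andPair I g := by
  simp [csupp]

/-- Membership in the total support. -/
theorem mem_gsupp {I : LocalMap 4 n m} {𝒲 : Finset (Finset (Fin n) × Finset (Fin m) × Bool)} {v : Fin n} :
    v ∈ gsupp I 𝒲 ↔ ∃ w ∈ 𝒲, v ∈ csupp I w := by
  simp [gsupp]

/-- The linear part of a constraint lies in the total support. -/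
theorem subset_gsupp (I : LocalMap 4 n m) {𝒲 : Finset (Finset (Fin n) × Finset (Fin m) × Bool)}
    {w : Finset (Fin n) × Finset (Fin m) × Bool} (hw : w ∈ 𝒲) : w.1 ⊆ gsupp I 𝒲 :=
  fun _ hv => mem_gsupp.2 ⟨w, hw, mem_csupp.2 (Or.inl hv)⟩

/-- The AND pair of a monomial lies in the total support. -/
theorem andPair_subset_gsupp (I : LocalMap 4 n m) {𝒲 : Finset (Finset (Fin n) × Finset (Fin m) × Bool)}
    {w : Finset (Fin n) × Finset (Fin m) × Bool} (hw : w ∈ 𝒲) {g : Fin m} (hg : g ∈ w.2.1) : andPair I g ⊆ gsupp I 𝒲 :=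
  fun _ hv => mem_gsupp.2 ⟨w, hw, mem_csupp.2 (Or.inr ⟨g, hg, hv⟩)⟩

/-- Size of the support of one constraint: `≤ |C| + 2|G|`. -/
theorem card_csupp_le (I : LocalMap 4 n m) (w : Finset (Fin n) × Finset (Fin m) × Bool) :
    (csupp I w).card ≤ w.1.card + 2 * w.2.1.card := by
  unfold csupp
  refine (card_union_le _ _).trans (Nat.add_le_add_left ?_ _)
  refine card_biUnion_le.trans ?_
  calc ∑ g ∈ w.2.1, (andPair I g).card ≤ ∑ _g ∈ w.2.1, 2 := sum_le_sum fun g _ => by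
          unfold PstarGapLinearised.andPair; exact card_insert_le _ _ |>.trans (by rw [card_singleton])
    _ = 2 * w.2.1.card := by rw [sum_const, smul_eq_mul, mul_comm]

/-- Size of the total support: `≤ Σ_w (|C_w| + 2|G_w|)`. -/
theorem card_gsupp_le (I : LocalMap 4 n m) (𝒲 : Finset (Finset (Fin n) × Finset (Fin m) × Bool)) :
    (gsupp I 𝒲).card ≤ ∑ w ∈ 𝒲, (w.1.card + 2 * w.2.1.card) := by
  unfold gsupp
  exact card_biUnion_le.trans (sum_le_sum fun w _ => card_csupp_le I w)

/-- A parity constraint, as a G-constraint, has support its variable set. -/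
theorem csupp_ofParity (I : LocalMap 4 n m) (w : Finset (Fin n) × Bool) : csupp I (ofParity m w) = w.1 := by
  simp [csupp, PstarReaderCoreSystem.ofParity]

/-- **The parity case**: the total support of a parity system in G-form is `PstarGapSupport.wsupp`. -/
theorem gsupp_parity (I : LocalMap 4 n m) (W : Finset (Finset (Fin n) × Bool)) : gsupp I (W.image (ofParity m)) = wsupp W := by
  classical
  ext v
  rw [mem_gsupp, mem_wsupp]
  constructor
  · rintro ⟨w', hw', hv⟩
    obtain ⟨w, hw, rfl⟩ := mem_image.1 hw'
    rw [csupp_ofParity] at hv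
    exact ⟨w, hw, hv⟩
  · rintro ⟨w, hw, hv⟩
    exact ⟨ofParity m w, mem_image_of_mem _ hw, by rw [csupp_ofParity]; exact hv⟩

/-! ## Variables outside the support are free for the system -/

/-- Updating a variable outside the support of a constraint does not change its value. -/
theorem gval_update_of_notMem_csupp (I : LocalMap 4 n m) {w : Finset (Fin n) × Finset (Fin m) × Bool} {v : Fin n}
    (hv : v ∉ csupp I w) (z : Fin n → Bool) (b : Bool) : gval I w.1 w.2.1 (Function.update z v b) = gval I w.1 w.2.1 z := by
  refine gval_update_of_forall_ne I z (fun h => hv (mem_csupp.2 (Or.inl h))) (fun g hg => ⟨?_, ?_⟩) b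
  · exact fun h => hv (mem_csupp.2 (Or.inr ⟨g, hg, h ▸ mem_andPair_of_slot I g 2 (by decide)⟩))
  · exact fun h => hv (mem_csupp.2 (Or.inr ⟨g, hg, h ▸ mem_andPair_of_slot I g 3 (by decide)⟩))

/-- Updating a variable outside the total support keeps the system satisfied. -/
theorem gholds_update_of_notMem (I : LocalMap 4 n m) {𝒲 : Finset (Finset (Fin n) × Finset (Fin m) × Bool)} {v : Fin n}
    (hv : v ∉ gsupp I 𝒲) {z : Fin n → Bool} (hz : ∀ w ∈ 𝒲, gval I w.1 w.2.1 z = w.2.2) (b : Bool) :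
    ∀ w ∈ 𝒲, gval I w.1 w.2.1 (Function.update z v b) = w.2.2 := by
  intro w hw
  rw [gval_update_of_notMem_csupp I (fun h => hv (mem_gsupp.2 ⟨w, hw, h⟩)) z b]
  exact hz w hw

/-- The value of the system is the same at two assignments that agree on its support. -/
theorem gval_update_iff_of_notMem (I : LocalMap 4 n m) {𝒲 : Finset (Finset (Fin n) × Finset (Fin m) × Bool)} {v : Fin n}
    (hv : v ∉ gsupp I 𝒲) (z : Fin n → Bool) (b : Bool) :
    (∀ w ∈ 𝒲, gval I w.1 w.2.1 (Function.update z v b) = w.2.2) ↔ ∀ w ∈ 𝒲, gval I w.1 w.2.1 z = w.2.2 := by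
  refine ⟨fun h w hw => ?_, fun h => gholds_update_of_notMem I hv h b⟩
  rw [← gval_update_of_notMem_csupp I (fun h' => hv (mem_gsupp.2 ⟨w, hw, h'⟩)) z b]
  exact h w hw

/-! ## The repair step: (C0) in general form -/

/-- **Repair without disturbing the system.**  If the output `j ∈ J` of a pure `P⋆` instance owns two `J`-private variables outside
the total support of `𝒲`, then a solution of `J ∖ {j}` with `𝒲` can be repaired into a solution of `J` with `𝒲`. -/
theorem solvable_of_two_private (I : LocalMap 4 n m) (hI : I.IsPure xorAndPred) (y : Fin m → Bool)
    (𝒲 : Finset (Finset (Fin n) × Finset (Fin m) × Bool)) {J : Finset (Fin m)} {j : Fin m} (hj : j ∈ J)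
    (hP : 2 ≤ ((bdry I J \ gsupp I 𝒲).filter fun v => v ∈ varSet I j).card)
    (hF : ∃ z : Fin n → Bool, (∀ j' ∈ J.erase j, I.eval z j' = y j') ∧ ∀ w ∈ 𝒲, gval I w.1 w.2.1 z = w.2.2) :
    ∃ z : Fin n → Bool, (∀ j' ∈ J, I.eval z j' = y j') ∧ ∀ w ∈ 𝒲, gval I w.1 w.2.1 z = w.2.2 := by
  classical
  set P := (bdry I J \ gsupp I 𝒲).filter fun v => v ∈ varSet I j with hPdef
  obtain ⟨z₀, hz₀, hW₀⟩ := hF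
  have hpriv : ∀ v ∈ P, ∀ j' ∈ J, j' ≠ j → v ∉ varSet I j' := fun v hv j' hj' hne' =>
    not_mem_varSet_of_private I hj hj' hne' (mem_sdiff.1 (mem_filter.1 hv).1).1 (mem_filter.1 hv).2
  have hout : ∀ v ∈ P, v ∉ gsupp I 𝒲 := fun v hv => (mem_sdiff.1 (mem_filter.1 hv).1).2
  have hslot : ∀ v ∈ P, ∃ s : Fin 4, I.vars j s = v := fun v hv => by
    have := (mem_filter.1 hv).2
    unfold PstarSALevel.varSet at this
    obtain ⟨s, -, hs⟩ := mem_image.1 this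
    exact ⟨s, hs⟩
  by_cases hx : ∃ s : Fin 4, s.val < 2 ∧ I.vars j s ∈ P
  · -- a private XOR slot outside the support: flip it if needed
    obtain ⟨s, hs, hsP⟩ := hx
    by_cases hok : I.eval z₀ j = y j
    · exact ⟨z₀, fun j' hj' => if h : j' = j then by rw [h]; exact hok else hz₀ j' (mem_erase.2 ⟨h, hj'⟩), hW₀⟩
    refine ⟨Function.update z₀ (I.vars j s) (!z₀ (I.vars j s)), fun j' hj' => ?_, gholds_update_of_notMem I (hout _ hsP) hW₀ _⟩
    by_cases h : j' = j
    · subst h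
      rw [eval_update_xor_slot I hI z₀ j' s hs]
      revert hok
      cases I.eval z₀ j' <;> cases y j' <;> simp
    · rw [eval_update_of_not_mem I j' z₀ (hpriv _ hsP j' hj' h)]
      exact hz₀ j' (mem_erase.2 ⟨h, hj'⟩)
  · -- both private variables are the AND slots
    push Not at hx
    have hPsub : P ⊆ {I.vars j 2, I.vars j 3} := by
      intro v hv
      obtain ⟨s, rfl⟩ := hslot v hv
      rw [mem_insert, mem_singleton]
      have hs2 : 2 ≤ s.val := by
        by_contra hlt2
        push Not at hlt2
        exact hx s hlt2 hv
      have : s = 2 ∨ s = 3 := by fin_cases s <;> simp at hs2 ⊢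
      rcases this with rfl | rfl
      · exact Or.inl rfl
      · exact Or.inr rfl
    have hPeq : P = {I.vars j 2, I.vars j 3} :=
      eq_of_subset_of_card_le hPsub ((card_insert_le _ _).trans (by rw [card_singleton]; exact hP))
    have h2P : I.vars j 2 ∈ P := by rw [hPeq]; simp
    have h3P : I.vars j 3 ∈ P := by rw [hPeq]; simp
    set c := xor (xor (z₀ (I.vars j 0)) (z₀ (I.vars j 1))) (y j) with hc
    refine ⟨Function.update (Function.update z₀ (I.vars j 2) c) (I.vars j 3) c, fun j' hj' => ?_,
      gholds_update_of_notMem I (hout _ h3P) (gholds_update_of_notMem I (hout _ h2P) hW₀ _) _⟩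
    by_cases h : j' = j
    · subst h
      rw [eval_update_and_pair I hI z₀ j' c, hc]
      cases z₀ (I.vars j' 0) <;> cases z₀ (I.vars j' 1) <;> cases y j' <;> rfl
    · rw [eval_update_of_not_mem I j' _ (hpriv _ h3P j' hj' h), eval_update_of_not_mem I j' _ (hpriv _ h2P j' hj' h)]
      exact hz₀ j' (mem_erase.2 ⟨h, hj'⟩)

/-- **(C0), chord form.**  If `J` is unsolvable with `𝒲` but `J ∖ {g}` is solvable with `𝒲`, then a chord `g` of `J` (both AND slots
`J`-private) has an AND slot in the total support of `𝒲`. -/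
theorem chord_meets_gsupp (I : LocalMap 4 n m) (hI : I.IsPure xorAndPred) (y : Fin m → Bool)
    (𝒲 : Finset (Finset (Fin n) × Finset (Fin m) × Bool)) {J : Finset (Fin m)}
    (hinf : ¬ ∃ z : Fin n → Bool, (∀ j ∈ J, I.eval z j = y j) ∧ ∀ w ∈ 𝒲, gval I w.1 w.2.1 z = w.2.2)
    {g : Fin m} (hg : g ∈ J) (hc : IsChord I J g)
    (hrest : ∃ z : Fin n → Bool, (∀ j' ∈ J.erase g, I.eval z j' = y j') ∧ ∀ w ∈ 𝒲, gval I w.1 w.2.1 z = w.2.2) :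
    I.vars g 2 ∈ gsupp I 𝒲 ∨ I.vars g 3 ∈ gsupp I 𝒲 := by
  classical
  by_contra hno
  push Not at hno
  refine hinf (solvable_of_two_private I hI y 𝒲 hg ?_ hrest)
  have h23 : I.vars g 2 ≠ I.vars g 3 := fun h => absurd (hI.2 g h) (by decide)
  have hsub : ({I.vars g 2, I.vars g 3} : Finset (Fin n)) ⊆ (bdry I J \ gsupp I 𝒲).filter fun v => v ∈ varSet I g := by
    intro v hv
    rw [mem_insert, mem_singleton] at hv
    rcases hv with rfl | rfl
    · exact mem_filter.2 ⟨mem_sdiff.2 ⟨hc.1, hno.1⟩, mem_image.2 ⟨2, mem_univ _, rfl⟩⟩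
    · exact mem_filter.2 ⟨mem_sdiff.2 ⟨hc.2, hno.2⟩, mem_image.2 ⟨3, mem_univ _, rfl⟩⟩
  have := card_le_card hsub
  rwa [card_pair h23] at this

/-! ## The support-charged counts -/

section Count

variable (I : LocalMap 4 n m) (hI : I.IsPure xorAndPred) (y : Fin m → Bool)
  (𝒲 : Finset (Finset (Fin n) × Finset (Fin m) × Bool)) {J : Finset (Fin m)}
  (hinf : ¬ ∃ z : Fin n → Bool, (∀ j ∈ J, I.eval z j = y j) ∧ ∀ w ∈ 𝒲, gval I w.1 w.2.1 z = w.2.2)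
  (hmin : ∀ j ∈ J, ∃ z : Fin n → Bool, (∀ j' ∈ J.erase j, I.eval z j' = y j') ∧ ∀ w ∈ 𝒲, gval I w.1 w.2.1 z = w.2.2)

include hI hinf hmin

/-- **A minimally unsolvable `J` has at most `|J|` boundary variables outside the support of the system.** -/
theorem card_bdry_sdiff_gsupp_le : (bdry I J \ gsupp I 𝒲).card ≤ J.card := by
  by_contra hlt
  push Not at hlt
  obtain ⟨j, hj, hP⟩ := exists_two_private I J (gsupp I 𝒲) hlt
  exact hinf (solvable_of_two_private I hI y 𝒲 hj hP (hmin j hj))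

/-- **The support-charged bound (★) for G-constraint systems.**  On a pure `(r, 3/2)`-boundary expanding instance, a set `J` of at
most `r` outputs that is minimally unsolvable together with the system `𝒲` satisfies `|J| ≤ 2·|bdry J ∩ gsupp 𝒲|`. -/
theorem card_le_two_mul_card_bdry_inter_gsupp {r : ℕ} (hB : BoundaryExpanding r I) (hJr : J.card ≤ r) :
    J.card ≤ 2 * (bdry I J ∩ gsupp I 𝒲).card := by
  have h1 := card_bdry_sdiff_gsupp_le I hI y 𝒲 hinf hmin
  have h2 := hB J hJr
  have h3 := card_sdiff_add_card_inter (bdry I J) (gsupp I 𝒲)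
  omega

/-- Hence `|J| ≤ 2·|gsupp 𝒲|`. -/
theorem card_le_two_mul_card_gsupp {r : ℕ} (hB : BoundaryExpanding r I) (hJr : J.card ≤ r) :
    J.card ≤ 2 * (gsupp I 𝒲).card :=
  (card_le_two_mul_card_bdry_inter_gsupp I hI y 𝒲 hinf hmin hB hJr).trans
    (Nat.mul_le_mul_left 2 (card_le_card inter_subset_right))

/-- And `|J| ≤ 2·Σ_w (|C_w| + 2|G_w|)`: few constraints with small linear parts and few monomials kill few outputs. -/
theorem card_le_two_mul_sum {r : ℕ} (hB : BoundaryExpanding r I) (hJr : J.card ≤ r) :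
    J.card ≤ 2 * ∑ w ∈ 𝒲, (w.1.card + 2 * w.2.1.card) :=
  (card_le_two_mul_card_gsupp I hI y 𝒲 hinf hmin hB hJr).trans (Nat.mul_le_mul_left 2 (card_gsupp_le I 𝒲))

end Count

/-! ## Under (T1): only AND-slot variables are charged -/

/-- With no `J`-private XOR slot (terminal form (T1)), every boundary variable of `J` is an AND-slot variable of an output of `J`. -/
theorem bdry_subset_biUnion_andPair (I : LocalMap 4 n m) {J : Finset (Fin m)}
    (hnx : ∀ g ∈ J, ∀ s : Fin 4, s.val < 2 → I.vars g s ∉ bdry I J) : bdry I J ⊆ J.biUnion (andPair I) := by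
  classical
  intro v hv
  have hv' := hv
  unfold PstarSALevel.bdry at hv'
  rw [mem_filter, card_eq_one] at hv'
  obtain ⟨f, hf⟩ := hv'.2
  have hfm : f ∈ J.filter fun j => v ∈ varSet I j := by rw [hf]; exact mem_singleton_self f
  obtain ⟨hfJ, hvf⟩ := mem_filter.1 hfm
  unfold PstarSALevel.varSet at hvf
  obtain ⟨s, -, hs⟩ := mem_image.1 hvf
  rw [mem_biUnion]
  refine ⟨f, hfJ, ?_⟩
  by_cases hs2 : s.val < 2
  · exact absurd (hs ▸ hv) (hnx f hfJ s hs2)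
  · push Not at hs2
    exact hs ▸ mem_andPair_of_slot I f s hs2

/-- **(★) under (T1).**  With no `J`-private XOR slot, `|J| ≤ 2·|{AND-slot variables of J that are J-private and in gsupp 𝒲}|` — the
memo's `|J₀| ≤ 2·|S ∩ priv(J₀)|` with `S` the AND-support of the system. -/
theorem card_le_two_mul_card_andBdry_inter_gsupp (I : LocalMap 4 n m) (hI : I.IsPure xorAndPred) (y : Fin m → Bool)
    (𝒲 : Finset (Finset (Fin n) × Finset (Fin m) × Bool)) {J : Finset (Fin m)}
    (hinf : ¬ ∃ z : Fin n → Bool, (∀ j ∈ J, I.eval z j = y j) ∧ ∀ w ∈ 𝒲, gval I w.1 w.2.1 z = w.2.2)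
    (hmin : ∀ j ∈ J, ∃ z : Fin n → Bool, (∀ j' ∈ J.erase j, I.eval z j' = y j') ∧ ∀ w ∈ 𝒲, gval I w.1 w.2.1 z = w.2.2)
    {r : ℕ} (hB : BoundaryExpanding r I) (hJr : J.card ≤ r)
    (hnx : ∀ g ∈ J, ∀ s : Fin 4, s.val < 2 → I.vars g s ∉ bdry I J) :
    J.card ≤ 2 * (J.biUnion (andPair I) ∩ bdry I J ∩ gsupp I 𝒲).card := by
  classical
  have h := card_le_two_mul_card_bdry_inter_gsupp I hI y 𝒲 hinf hmin hB hJr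
  have hsub : bdry I J ∩ gsupp I 𝒲 ⊆ J.biUnion (andPair I) ∩ bdry I J ∩ gsupp I 𝒲 := by
    intro v hv
    rw [mem_inter] at hv
    exact mem_inter.2 ⟨mem_inter.2 ⟨bdry_subset_biUnion_andPair I hnx hv.1, hv.1⟩, hv.2⟩
  exact h.trans (Nat.mul_le_mul_left 2 (card_le_card hsub))

/-! ## Sanity: the parity case is `PstarGapSupport` -/

/-- The G-system form of a minimal `W`-infeasible `J` (parity system `W`): unsolvable, every `J ∖ {j}` solvable. -/
theorem parity_shape (I : LocalMap 4 n m) {y : Fin m → Bool} {W : Finset (Finset (Fin n) × Bool)} {J : Finset (Fin m)}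
    (hmin : PstarGapLemma.MinInfeasible I y W J) :
    (¬ ∃ z : Fin n → Bool, (∀ j ∈ J, I.eval z j = y j) ∧ ∀ w ∈ W.image (ofParity m), gval I w.1 w.2.1 z = w.2.2) ∧
      ∀ j ∈ J, ∃ z : Fin n → Bool, (∀ j' ∈ J.erase j, I.eval z j' = y j') ∧
        ∀ w ∈ W.image (ofParity m), gval I w.1 w.2.1 z = w.2.2 := by
  refine ⟨?_, fun j hj => ?_⟩
  · rintro ⟨z, hzJ, hzW⟩
    exact hmin.1 ⟨z, (PstarReaderCoreSystem.gholds_ofParity_iff I W z).1 hzW, hzJ⟩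
  · obtain ⟨z, hzW, hzJ⟩ := hmin.2 j hj
    exact ⟨z, hzJ, (PstarReaderCoreSystem.gholds_ofParity_iff I W z).2 hzW⟩

/-- Recovering `PstarGapSupport.card_le_two_mul_card_bdry_inter` from the G-system bound. -/
theorem card_le_two_mul_card_bdry_inter_wsupp (I : LocalMap 4 n m) (hI : I.IsPure xorAndPred) {r : ℕ} (hB : BoundaryExpanding r I)
    {y : Fin m → Bool} {W : Finset (Finset (Fin n) × Bool)} {J : Finset (Fin m)} (hJr : J.card ≤ r)
    (hmin : PstarGapLemma.MinInfeasible I y W J) : J.card ≤ 2 * (bdry I J ∩ wsupp W).card := by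
  obtain ⟨hinf, hmin'⟩ := parity_shape I hmin
  rw [← gsupp_parity I W]
  exact card_le_two_mul_card_bdry_inter_gsupp I hI y _ hinf hmin' hB hJr

end Summit.PneNP.PneNP.Theorems.PstarGSystemSupport
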